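import Summits.QuantumFields.BalabanUV.T4Continuum.Support.NE3HilbertSchmidtTorus
import Summits.QuantumFields.BalabanUV.T4Continuum.Support.NE3SpectralCutSymmetry
import Mathlib.Analysis.InnerProductSpace.Adjoint
import HarnessLib

/-!
# NE3CovariantAdjointTorus (T⁴ programme, node NE3, row K1-inst of the owner's ruling ρ-g22-2, file 3∕4) — THE ADJOINT `D_W† = covDiv W` BY
# NAME, THE ANTI-INVOLUTION `X ↦ −Xᴴ` COMMUTING WITH `D_W`, `D_W†`, `D_W†D_W`, AND THE HODGE SPLIT `Y = D_W a + z`, `D_W† z = 0` ON THE TORUS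

NE3 (node U1b) formalisation swarm `b2b-balaban-t4-ne3-formalise-*`, leaf seat `b2b-balaban-t4-ne3-formalise-leaf-02` (gen 6), row
**K1-inst** of the owner's ruling ρ-g22-2 («package `D_W` on periodic 𝔤-valued sections as a `LinearMap` between `PiLp` spaces», owner journal
l.17786 ∕ l.18064; design `HOME/t4/b2b-balaban-t4-ne3-p1/g22/D-ne3p1-g22-1.md` steps S1∕S2; my INTENT ∕ CLAIM `HOME/CLAIMS.log` l.18383).
THE ROW'S FILES: (1∕4) `NE3SpectralCutSymmetry` (abstract supplement to the owner's kit `NE3SpectralCut` p227224 ∕ `NE3SpectralCutGram` p227494),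
(2∕4) `NE3HilbertSchmidtTorus` (the real Hilbert–Schmidt `PiLp` packaging and `DW W P`), (3∕4) `NE3CovariantAdjointTorus` (`D_W† = covDiv W`,
the anti-involution `X ↦ −Xᴴ`, the torus Hodge split), (4∕4) `NE3SpectralCutTorus` (S2 and S1 in lattice currency + the S1∘S2 package).
THIS FILE (over file 2's `Sec`∕`Form`∕`DW` and file 1's `eq_of_add_eq_add_of_mem_orthogonal`; all [folklore], 0 sorry; DATA defs `starNegS`, `starNegF`):
§1 **`adjoint_DW_apply`**: for unitary `W` and `1 ≤ P`, `LinearMap.adjoint (DW W P) b = resS P (covDiv W (extF P b))` — the Hilbert-space adjoint of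
   `D_W` IS the tree's covariant backward divergence `NE3CovariantWeitzenbock.covDiv` (leaf-04's `NE3LandauOrbit.sum_hsR_gaugeDir` read through
   `ext_inner_right`; no smallness, no curvature); `gram_DW_apply`∕`extS_gram_DW` (`(D_W†∘D_W) a = resS P (covDiv W (gaugeDir W (extS a)))`, `P`-periodic `W`),
   `adjoint_DW_eq_zero_iff` (`D_W† b = 0 ↔ covDiv W (extF b) = 0`);
§2 the anti-involutions `starNegS`∕`starNegF` (`X ↦ −Xᴴ` sitewise ∕ bondwise, `ℝ`-linear, involutive, `⟪·,·⟫`-symmetric), the matrix identities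
   `hsR Xᴴ Y = hsR X Yᴴ` (trace cyclicity = `NE3HessBounds.nReTr_mul_comm`), `(Ad_u X)ᴴ = Ad_u Xᴴ` (unitary `u`), `gaugeDir W (−ζᴴ) = −(gaugeDir W ζ)ᴴ`, `covDiv W (−Yᴴ) = −(covDiv W Y)ᴴ`, hence
   **`DW_starNegS`**, **`adjoint_DW_starNegF`**, **`gram_DW_starNegS`** (unitary `W`): `D_W`, `D_W†`, `D_W†D_W` commute with `X ↦ −Xᴴ`; fixed points ↔ 𝔲(n)-values;
§3 **`exists_torusHodge`** (`Yt = D_W a + z`, `z ∈ (range D_W)ᗮ`, `D_W† z = 0`, `⟪D_W a, z⟫ = 0`; Mathlib `Submodule.exists_add_mem_mem_orthogonal` on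
   `range (DW W P)`) and **`exists_torusHodge_fixed`**: for a `starNegF`-fixed `Yt` the co-closed part is fixed and the potential may be taken
   `starNegS`-fixed (uniqueness of the orthogonal splitting + symmetrisation `a ↦ ½(a + starNegS a)`).
HONEST FRAMING.  Finite-dimensional linear algebra on OUR lattice objects at ONE unitary background; nothing about Bałaban's minimisers;
(P♮)_W, (ML_w) at `W ≠ 1`, T-E_w and NE3 are NOT proved; spine PROVED 0∕9; finite T⁴ rung (B)+1 — NOT infinite volume, NOT mass gap, NOT
BetaPertH, NOT Clay.  ABSOLUTE RULE kept: no printed sentence is a hypothesis (context only: [Balaban1985Averaging] (17)–(19) pp. 20–21, the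
normalised Hilbert–Schmidt scalar product; [Balaban1985Variational] (83) p. 290, the Landau-gauge restriction).  PLACEMENT:
`Summits/QuantumFields/BalabanUV/` (our frame); moves nothing.  HONEST DEPENDENCY: continuum YM on T⁴ ⇐ BetaPertH ∧ nine spine estimates
(0/9 proved); BetaPertH ⇐ (D1) ∧ (D4) ∧ CAP+tail; G-an2-4 gates asym, D1 and NE2/3/4.
-/

set_option autoImplicit false

open scoped BigOperators InnerProductSpace Matrix
open Finset

namespace Summit.QuantumFields.BalabanUV.T4Continuum.NE3CovariantAdjointTorus

open Literature.MathematicalPhysics.QuantumFieldTheory.Balaban1983to89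
open B7Prop1Explicit B7Prop2Explicit MatrixNorms UnitaryModel
open T4AveragingDeficitWall (IsUnitaryCfg IsSkewDir Ad)
open T4AveragingDeficitWallBoundary (IsPeriodicCfg periodBox)
open AveragingDeficitPeriodicCounting (IsPeriodicDir)
open AveragingDeficitNearIdentity (Ad_neg)
open AveragingDeficitTransport (val_inv_eq_star_of_unitary)
open BlockAveragePushDirGauge (gaugeDir isPeriodicDir_gaugeDir)
open NE3CovariantCalculus (hsR hsR_comm hsR_self)
open NE3CovariantWeitzenbock (covDiv)
open NE3LandauOrbit (hsR_neg_right covDiv_add_period sum_hsR_gaugeDir)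
open NE3FrameFreeDecompositionPrep (hsR_neg_left)
open NE3SpectralCutSymmetry (eq_of_add_eq_add_of_mem_orthogonal)
open NE3HilbertSchmidtTorus NE3HilbertSchmidtTorus.HSMat

noncomputable section

variable {d : ℕ} {n : Type*} [Fintype n] [DecidableEq n]

/-! ## §1 The adjoint of `D_W` is the covariant backward divergence `covDiv W` -/

/-- **THE ADJOINT BY NAME**: for a unitary background `W` and `1 ≤ P`, the Hilbert-space adjoint of `D_W` on the torus is the tree's
covariant backward divergence: `D_W† b = resS P (covDiv W (extF P b))` (leaf-04's Landau orthogonality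
`NE3LandauOrbit.sum_hsR_gaugeDir`, no smallness, no curvature). [folklore] -/
theorem adjoint_DW_apply {W : Site d → Fin d → (Matrix n n ℂ)ˣ} (hWu : IsUnitaryCfg W) {P : ℕ} [NeZero P] (hP : 1 ≤ P) (b : Form d n P) :
    LinearMap.adjoint (DW W P) b = resS P (covDiv W (extF P b)) := by
  refine ext_inner_right ℝ fun a => ?_
  rw [LinearMap.adjoint_inner_left, inner_DW_right,
    sum_hsR_gaugeDir hP hWu (isPeriodicDir_extF P b) (extS_add_period P a)]
  conv_rhs => rw [← resS_extS P a]
  rw [inner_resS]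

/-- The extension of `D_W† b` is `covDiv W (extF b)` for a `P`-periodic background. [folklore] -/
theorem extS_adjoint_DW {W : Site d → Fin d → (Matrix n n ℂ)ˣ} (hWu : IsUnitaryCfg W) {P : ℕ} [NeZero P] (hP : 1 ≤ P)
    (hWP : IsPeriodicCfg W (P : ℤ)) (b : Form d n P) :
    extS P (LinearMap.adjoint (DW W P) b) = covDiv W (extF P b) := by
  rw [adjoint_DW_apply hWu hP, extS_resS P (NE3LandauOrbit.covDiv_add_period hWP (isPeriodicDir_extF P b))]

/-- **THE GRAM OPERATOR BY NAME**: `(D_W† ∘ D_W) a = resS P (covDiv W (gaugeDir W (extS P a)))` (unitary `P`-periodic `W`). [folklore] -/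
theorem gram_DW_apply {W : Site d → Fin d → (Matrix n n ℂ)ˣ} (hWu : IsUnitaryCfg W) {P : ℕ} [NeZero P] (hP : 1 ≤ P)
    (hWP : IsPeriodicCfg W (P : ℤ)) (a : Sec d n P) :
    (LinearMap.adjoint (DW W P) ∘ₗ DW W P) a = resS P (covDiv W (gaugeDir W (extS P a))) := by
  rw [LinearMap.comp_apply, adjoint_DW_apply hWu hP, extF_DW hWP]

/-- The extension of `(D_W† ∘ D_W) a` is `covDiv W (gaugeDir W (extS a))` (unitary `P`-periodic `W`). [folklore] -/
theorem extS_gram_DW {W : Site d → Fin d → (Matrix n n ℂ)ˣ} (hWu : IsUnitaryCfg W) {P : ℕ} [NeZero P] (hP : 1 ≤ P)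
    (hWP : IsPeriodicCfg W (P : ℤ)) (a : Sec d n P) :
    extS P ((LinearMap.adjoint (DW W P) ∘ₗ DW W P) a) = covDiv W (gaugeDir W (extS P a)) := by
  rw [LinearMap.comp_apply, extS_adjoint_DW hWu hP hWP, extF_DW hWP]

/-- `D_W† b = 0` iff `covDiv W (extF b)` vanishes on the period box (unitary `P`-periodic `W`). [folklore] -/
theorem adjoint_DW_eq_zero_iff {W : Site d → Fin d → (Matrix n n ℂ)ˣ} (hWu : IsUnitaryCfg W) {P : ℕ} [NeZero P] (hP : 1 ≤ P)
    (hWP : IsPeriodicCfg W (P : ℤ)) (b : Form d n P) :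
    LinearMap.adjoint (DW W P) b = 0 ↔ ∀ x : Site d, covDiv W (extF P b) x = 0 := by
  constructor
  · intro h x
    have h1 := extS_adjoint_DW hWu hP hWP b
    rw [h] at h1
    have h2 : extS P (0 : Sec d n P) x = 0 := rfl
    rw [← h1]; exact h2
  · intro h
    rw [adjoint_DW_apply hWu hP]
    ext s : 1
    rw [resS_apply, h]
    rfl


/-! ## §2 The anti-involution `X ↦ −Xᴴ` on torus sections and 1-forms; compatibility with `D_W`, `D_W†` -/

omit [DecidableEq n] in
/-- `hsR Xᴴ Y = hsR X Yᴴ` (both are `Re tr(XY)∕n`). [folklore] -/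
theorem hsR_conjTranspose_left (X Y : Matrix n n ℂ) : hsR Xᴴ Y = hsR X Yᴴ := by
  unfold hsR
  rw [Matrix.conjTranspose_conjTranspose, ← Matrix.conjTranspose_mul, nReTr_conjTranspose, NE3HessBounds.nReTr_mul_comm]

/-- `X ↦ −Xᴴ` is `hsR`-symmetric: `hsR (−Xᴴ) Y = hsR X (−Yᴴ)`. [folklore] -/
theorem hsR_neg_conjTranspose_symm (X Y : Matrix n n ℂ) : hsR (-Xᴴ) Y = hsR X (-Yᴴ) := by
  rw [hsR_neg_left, hsR_neg_right, hsR_conjTranspose_left]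

/-- For unitary `u`, `(Ad_u X)ᴴ = Ad_u Xᴴ`. [folklore] -/
theorem conjTranspose_Ad {u : (Matrix n n ℂ)ˣ} (hu : u ∈ unitaryUnits (Matrix n n ℂ)) (X : Matrix n n ℂ) : (Ad u X)ᴴ = Ad u Xᴴ := by
  unfold Ad
  rw [Matrix.conjTranspose_mul, Matrix.conjTranspose_mul, val_inv_eq_star_of_unitary hu, Matrix.star_eq_conjTranspose,
    Matrix.conjTranspose_conjTranspose, Matrix.mul_assoc]

/-- `gaugeDir W (−ζᴴ) = −(gaugeDir W ζ)ᴴ` at a unitary background. [folklore] -/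
theorem gaugeDir_neg_conjTranspose {W : Site d → Fin d → (Matrix n n ℂ)ˣ} (hWu : IsUnitaryCfg W) (f : Site d → Matrix n n ℂ)
    (x : Site d) (μ : Fin d) : gaugeDir W (fun y => -(f y)ᴴ) x μ = -(gaugeDir W f x μ)ᴴ := by
  simp only [gaugeDir]
  rw [Ad_neg, Matrix.conjTranspose_sub, conjTranspose_Ad ((unitaryUnits (Matrix n n ℂ)).inv_mem (hWu x μ))]
  abel

/-- `covDiv W (−Yᴴ) = −(covDiv W Y)ᴴ` at a unitary background. [folklore] -/
theorem covDiv_neg_conjTranspose {W : Site d → Fin d → (Matrix n n ℂ)ˣ} (hWu : IsUnitaryCfg W) (Y : Site d → Fin d → Matrix n n ℂ)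
    (x : Site d) : covDiv W (fun y κ => -(Y y κ)ᴴ) x = -(covDiv W Y x)ᴴ := by
  simp only [covDiv]
  rw [Matrix.conjTranspose_sum, ← Finset.sum_neg_distrib]
  refine Finset.sum_congr rfl fun μ _ => ?_
  rw [Ad_neg, Matrix.conjTranspose_sub, conjTranspose_Ad (hWu x μ)]
  abel

/-- **THE ANTI-INVOLUTION `X ↦ −Xᴴ` SITEWISE** on torus sections, as an `ℝ`-linear map. [folklore] -/
def starNegS (P : ℕ) : Sec d n P →ₗ[ℝ] Sec d n P where
  toFun a := WithLp.toLp 2 fun s => toHS (-(ofHS (a s))ᴴ)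
  map_add' a b := by
    ext s : 1
    simp only [PiLp.add_apply, ofHS_add, Matrix.conjTranspose_add, neg_add, toHS_add]
  map_smul' t a := by
    ext s : 1
    simp only [PiLp.smul_apply, ofHS_smul, RingHom.id_apply]
    rw [Matrix.conjTranspose_smul, star_trivial, ← smul_neg, toHS_smul]

/-- `starNegS a` evaluated. [folklore] -/
theorem starNegS_apply (P : ℕ) (a : Sec d n P) (s : Fin d → Fin P) : starNegS P a s = toHS (-(ofHS (a s))ᴴ) := rfl

/-- The extension of `starNegS a` is `−(extS a)ᴴ` sitewise. [folklore] -/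
theorem extS_starNegS (P : ℕ) [NeZero P] (a : Sec d n P) (x : Site d) : extS P (starNegS P a) x = -(extS P a x)ᴴ := rfl

/-- `starNegS (resS f) = resS (−fᴴ)`. [folklore] -/
theorem starNegS_resS (P : ℕ) (f : Site d → Matrix n n ℂ) : starNegS P (resS (d := d) P f) = resS P (fun x => -(f x)ᴴ) := by
  ext s : 1; rfl

/-- `starNegS` is `⟪·,·⟫`-symmetric. [folklore] -/
theorem inner_starNegS_left (P : ℕ) [NeZero P] (a b : Sec d n P) : ⟪starNegS P a, b⟫_ℝ = ⟪a, starNegS P b⟫_ℝ := by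
  rw [inner_eq_sum_extS, inner_eq_sum_extS]
  exact Finset.sum_congr rfl fun x _ => by rw [extS_starNegS, extS_starNegS, hsR_neg_conjTranspose_symm]

/-- **`D_W†D_W` COMMUTES WITH `starNegS`** (unitary `P`-periodic `W`, `1 ≤ P`). [folklore] -/
theorem gram_DW_starNegS {W : Site d → Fin d → (Matrix n n ℂ)ˣ} (hWu : IsUnitaryCfg W) {P : ℕ} [NeZero P] (hP : 1 ≤ P)
    (hWP : IsPeriodicCfg W (P : ℤ)) (a : Sec d n P) :
    (LinearMap.adjoint (DW W P) ∘ₗ DW W P) (starNegS P a) = starNegS P ((LinearMap.adjoint (DW W P) ∘ₗ DW W P) a) := by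
  rw [gram_DW_apply hWu hP hWP, gram_DW_apply hWu hP hWP, starNegS_resS]
  congr 1
  funext x
  rw [← covDiv_neg_conjTranspose hWu]
  congr 1
  funext y κ
  rw [← gaugeDir_neg_conjTranspose hWu]
  rfl

/-- A 𝔲(n)-valued `P`-periodic `ζ` restricts to a `starNegS`-fixed torus section. [folklore] -/
theorem starNegS_resS_of_skew (P : ℕ) {ζ : Site d → Matrix n n ℂ} (hζs : ∀ x : Site d, ζ x ∈ skewAdjoint (Matrix n n ℂ)) :
    starNegS P (resS (d := d) P ζ) = resS P ζ := by
  rw [starNegS_resS]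
  congr 1
  funext x
  have h := hζs x
  rw [skewAdjoint.mem_iff, Matrix.star_eq_conjTranspose] at h
  rw [h, neg_neg]




/-- **THE ANTI-INVOLUTION `X ↦ −Xᴴ` BONDWISE** on torus 1-forms, as an `ℝ`-linear map. [folklore] -/
def starNegF (P : ℕ) : Form d n P →ₗ[ℝ] Form d n P where
  toFun b := WithLp.toLp 2 fun p => toHS (-(ofHS (b p))ᴴ)
  map_add' a b := by
    ext p : 1
    simp only [PiLp.add_apply, ofHS_add, Matrix.conjTranspose_add, neg_add, toHS_add]
  map_smul' t a := by
    ext p : 1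
    simp only [PiLp.smul_apply, ofHS_smul, RingHom.id_apply]
    rw [Matrix.conjTranspose_smul, star_trivial, ← smul_neg, toHS_smul]

/-- The extension of `starNegF b` is `−(extF b)ᴴ` bondwise. [folklore] -/
theorem extF_starNegF (P : ℕ) [NeZero P] (b : Form d n P) (x : Site d) (κ : Fin d) : extF P (starNegF P b) x κ = -(extF P b x κ)ᴴ := rfl

/-- `starNegF (resF Y) = resF (−Yᴴ)`. [folklore] -/
theorem starNegF_resF (P : ℕ) (Y : Site d → Fin d → Matrix n n ℂ) :
    starNegF P (resF (d := d) P Y) = resF P (fun x κ => -(Y x κ)ᴴ) := by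
  ext p : 1; rfl

/-- `starNegF` is an involution. [folklore] -/
theorem starNegF_starNegF (P : ℕ) (b : Form d n P) : starNegF P (starNegF P b) = b := by
  ext p : 1
  show toHS (-(ofHS (toHS (-(ofHS (b p))ᴴ)))ᴴ) = b p
  rw [ofHS_toHS, Matrix.conjTranspose_neg, Matrix.conjTranspose_conjTranspose, neg_neg, toHS_ofHS]

/-- `starNegS` is an involution. [folklore] -/
theorem starNegS_starNegS (P : ℕ) (a : Sec d n P) : starNegS P (starNegS P a) = a := by
  ext s : 1
  show toHS (-(ofHS (toHS (-(ofHS (a s))ᴴ)))ᴴ) = a s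
  rw [ofHS_toHS, Matrix.conjTranspose_neg, Matrix.conjTranspose_conjTranspose, neg_neg, toHS_ofHS]

/-- A 𝔲(n)-valued direction field restricts to a `starNegF`-fixed torus 1-form. [folklore] -/
theorem starNegF_resF_of_skew (P : ℕ) {Y : Site d → Fin d → Matrix n n ℂ} (hYs : IsSkewDir Y) :
    starNegF P (resF (d := d) P Y) = resF P Y := by
  rw [starNegF_resF]
  congr 1
  funext x κ
  have h := hYs x κ
  rw [skewAdjoint.mem_iff, Matrix.star_eq_conjTranspose] at h
  rw [h, neg_neg]

/-- A `starNegF`-fixed torus 1-form extends to a 𝔲(n)-valued direction field. [folklore] -/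
theorem isSkewDir_extF_of_fixed (P : ℕ) [NeZero P] {b : Form d n P} (hb : starNegF P b = b) : IsSkewDir (extF P b) := by
  intro x κ
  have hx := congrArg (fun c : Form d n P => extF P c x κ) hb
  simp only [extF_starNegF] at hx
  rw [skewAdjoint.mem_iff, Matrix.star_eq_conjTranspose]
  exact neg_eq_iff_eq_neg.mp hx

/-- A `starNegS`-fixed torus section extends to a 𝔲(n)-valued site field. [folklore] -/
theorem extS_mem_skewAdjoint_of_fixed (P : ℕ) [NeZero P] {a : Sec d n P} (ha : starNegS P a = a) (x : Site d) :
    extS P a x ∈ skewAdjoint (Matrix n n ℂ) := by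
  have hx := congrArg (fun c : Sec d n P => extS P c x) ha
  simp only [extS_starNegS] at hx
  rw [skewAdjoint.mem_iff, Matrix.star_eq_conjTranspose]
  exact neg_eq_iff_eq_neg.mp hx

/-- **`D_W ∘ starNegS = starNegF ∘ D_W`** at a unitary background. [folklore] -/
theorem DW_starNegS {W : Site d → Fin d → (Matrix n n ℂ)ˣ} (hWu : IsUnitaryCfg W) (P : ℕ) [NeZero P] (a : Sec d n P) :
    DW W P (starNegS P a) = starNegF P (DW W P a) := by
  rw [DW_apply, DW_apply, starNegF_resF]
  congr 1
  funext x κ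
  rw [← gaugeDir_neg_conjTranspose hWu]
  rfl

/-- **`D_W† ∘ starNegF = starNegS ∘ D_W†`** at a unitary background (`1 ≤ P`). [folklore] -/
theorem adjoint_DW_starNegF {W : Site d → Fin d → (Matrix n n ℂ)ˣ} (hWu : IsUnitaryCfg W) {P : ℕ} [NeZero P] (hP : 1 ≤ P) (b : Form d n P) :
    LinearMap.adjoint (DW W P) (starNegF P b) = starNegS P (LinearMap.adjoint (DW W P) b) := by
  rw [adjoint_DW_apply hWu hP, adjoint_DW_apply hWu hP, starNegS_resS]
  congr 1
  funext x
  rw [← covDiv_neg_conjTranspose hWu]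
  rfl


/-! ## §3 The Hodge split on the torus -/

/-- **THE TORUS HODGE SPLIT**: every torus 1-form is `D_W a + z` with `D_W† z = 0` and `D_W a ⊥ z`. [folklore] -/
theorem exists_torusHodge (W : Site d → Fin d → (Matrix n n ℂ)ˣ) (P : ℕ) [NeZero P] (Yt : Form d n P) :
    ∃ a : Sec d n P, ∃ z : Form d n P, Yt = DW W P a + z ∧ z ∈ (LinearMap.range (DW W P))ᗮ ∧
      LinearMap.adjoint (DW W P) z = 0 ∧ ⟪DW W P a, z⟫_ℝ = 0 := by
  set K : Submodule ℝ (Form d n P) := LinearMap.range (DW W P) with hK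
  haveI : CompleteSpace K := FiniteDimensional.complete ℝ K
  obtain ⟨r, hr, z, hz, hrz⟩ := K.exists_add_mem_mem_orthogonal Yt
  obtain ⟨a, har⟩ := LinearMap.mem_range.1 hr
  refine ⟨a, z, by rw [har]; exact hrz, hz, ?_, ?_⟩
  · refine ext_inner_left ℝ fun v => ?_
    rw [LinearMap.adjoint_inner_right, inner_zero_right]
    exact Submodule.inner_right_of_mem_orthogonal (LinearMap.mem_range_self _ v) hz
  · rw [har]; exact Submodule.inner_right_of_mem_orthogonal hr hz

/-- **`starNeg`-COMPATIBILITY OF THE SPLIT** (unitary `W`, `1 ≤ P`): for a `starNegF`-fixed `Yt` the co-closed part `z` is `starNegF`-fixed and the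
potential may be taken `starNegS`-fixed. [folklore] -/
theorem exists_torusHodge_fixed {W : Site d → Fin d → (Matrix n n ℂ)ˣ} (hWu : IsUnitaryCfg W) {P : ℕ} [NeZero P] (hP : 1 ≤ P)
    {Yt : Form d n P} (hYt : starNegF P Yt = Yt) :
    ∃ a : Sec d n P, ∃ z : Form d n P, Yt = DW W P a + z ∧ LinearMap.adjoint (DW W P) z = 0 ∧ ⟪DW W P a, z⟫_ℝ = 0 ∧
      starNegS P a = a ∧ starNegF P z = z := by
  obtain ⟨a, z, hYaz, hzK, hz0, horth⟩ := exists_torusHodge W P Yt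
  -- apply the anti-involution to the splitting and compare
  have hra : DW W P (starNegS P a) ∈ LinearMap.range (DW W P) := LinearMap.mem_range_self _ _
  have hzs : starNegF P z ∈ (LinearMap.range (DW W P))ᗮ := by
    rw [Submodule.mem_orthogonal]
    intro u hu
    obtain ⟨v, hv⟩ := LinearMap.mem_range.1 hu
    rw [← hv, ← LinearMap.adjoint_inner_right, adjoint_DW_starNegF hWu hP, hz0, map_zero, inner_zero_right]
  have hsplit : DW W P (starNegS P a) + starNegF P z = DW W P a + z := by
    rw [DW_starNegS hWu, ← map_add, ← hYaz, hYt]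
  obtain ⟨hr, hz⟩ := eq_of_add_eq_add_of_mem_orthogonal hra (LinearMap.mem_range_self _ a) hzs hzK hsplit
  -- the symmetrised potential
  refine ⟨(2 : ℝ)⁻¹ • (a + starNegS P a), z, ?_, hz0, ?_, ?_, hz⟩
  · rw [map_smul, map_add, hr, ← two_smul ℝ (DW W P a), smul_smul, inv_mul_cancel₀ (two_ne_zero), one_smul]
    exact hYaz
  · rw [map_smul, map_add, hr, ← two_smul ℝ (DW W P a), smul_smul, inv_mul_cancel₀ (two_ne_zero), one_smul]
    exact horth
  · rw [map_smul, map_add, starNegS_starNegS, add_comm]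


end

end Summit.QuantumFields.BalabanUV.T4Continuum.NE3CovariantAdjointTorus
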